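import Summits.QuantumFields.YangMills.Theorems.UnitScaleTiltProp7AxialGaugeBlock
import Summits.QuantumFields.YangMills.Theorems.UnitScaleTiltProp8IterAxialData
import HarnessLib

/-!
# Route `UnitScaleTilt`, crux K1 child «MinimiserStabilityRegPr» (stmt-QuantumFields-19200), registered stub `stub_prop7From14` (skeleton birth_v7
# cc37a178…; leaf V3 «Prop 7 from a background (14)») — THE COMB-AXIAL (4)-REPRESENTATIVE ON THE BONDS JOINING TWO `k`-BLOCKS:
# `dist1(W_bU₀,b⁻¹) ≤ B_k(e_W) + β + B_k(e₀)`, `B_k(e) = (100·L^{2k} + (7L^k)²/4)·e·L^{−2k} ≤ 113·e`, `β` = the distance of the two `k`-fold (0.4)-averages —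
# [Balaban1985RegularSpaces] Lemma 1 (1.25) «|V′ − 1| < 4d²α₀ + α₁», second half, `k`-fold relative form at the d = 3 carrier

Cell `ym3-torus` ∕ fleet seat `ym-ust-19200-p1` (gen 7; HUMAN RULING D-0037, YM ladder rung R3).  Completes the sup-norm description of print's space (18) at the
carrier begun in this seat's `…Prop7AxialGauge` ∕ `…AxialGaugeSup` ∕ `…AxialGaugeBlock` ∕ `…AxialSpace18` (interior bonds: `O(ε₀η)`): the FACE bonds.  Mechanism
([Balaban1985RegularSpaces] pp. 79–80, (1.26) ff.): the word `Γ₂ = Γ_{y,x} ∪ b ∪ (−Γ_{y′,x+e_μ})` runs from the centre `y` of the block of `x` to the centre `y′` of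
the neighbouring block through the face bond `b = ⟨x, μ⟩`; by comb-axiality `W(Γ₂) = U₀(Γ_{y,x})·W_b·U₀(Γ_{y′,x+e_μ})⁻¹`, so `W_bU₀,b⁻¹` is conjugate to
`W(Γ₂)U₀(Γ₂)⁻¹`; and BOTH `W(Γ₂)` and `U₀(Γ₂)` are within `B_k` of the respective `k`-fold (0.4)-averages at the coarse bond `⟨y, μ⟩` by the ★19200-p2 lineage's
transport comparison `IterPlaqSmall.dist1_contour_iter_le_T3` (p534871; block size `L ≥ 7`, `50(500L + 7L²)ε₀ ≤ 1`).  For two elements of ONE fibre the averages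
coincide (`β = 0`): the comb-axial representative of `W ∈ 𝔅_k(V)` relative to `U₀ ∈ 𝔅_k(V)` is `O(ε₀)`-close to `U₀` on EVERY bond, `k`-uniformly.

WHAT IS PROVED (sorry-free, no definition).  §1 bookkeeping: `disp_apply_eq_netDisp`, `netDisp_treeWord`, `walkEnd_treeWord_rel`, the UNIFORM centre
offset `exists_off_embIter`, `embIter_shift` (`y(x)` moves by `L^k·e_μ` with the block), `rel_centre_eq_off`, `val_shift_mod_of_face`, `iterBlockOf_shift_of_face`.
§2 generic: `holAt_faceWord_of_axial`, `netDisp_faceWord(_centre)`, `walkEnd_faceWord_centre`, `length_faceWord_le`, `dist1_mul_inv_le_three`.  §3 (d = 3):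
**`dist1_mul_inv_le_face_T3`** (the displayed bound) and **`dist1_mul_inv_le_face_of_descent_eq_T3`** (`β = 0`); with `…AxialGaugeBlock.
norm_pertVar_le_interior_T3` this bounds the comb-axial representative on ALL bonds.  HONEST SCOPE: `L ≥ 7`, `50(500L + 7L²)·e ≤ 1` for both radii (the
p2 lineage's discharge of «iterated averages small»); the constant is crude (print: `4d²`); nothing of [Balaban1985RegularSpaces] Thm 2 is claimed.
References: T. Bałaban, CMP 99 (1985) 75–102 [Balaban1985RegularSpaces] (Lemma 1 (1.24)–(1.26) pp.79–80); CMP 98 (1985) 17–51 [Balaban1985Averaging] ((19)–(20)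
p.21, pp.24–25); CMP 102 (1985) 277–309 [Balaban1985Variational] ((2)–(4) p.278, (18) p.280); CMP 109 (1987) 249–301 [Balaban1987RG1] ((0.4) p.253).
-/

noncomputable section
namespace Summit.QuantumFields.YangMills.Theorems.Prop7AxialGaugeFace

open scoped Matrix.Norms.L2Operator
open Literature.MathematicalPhysics.QuantumFieldTheory.Balaban1983to89
open T4Continuum T4ReflectionCone BlockAveraging
open B10Eq27TorusAxialLog (axialT rel rel_apply holT_eq_holAt)
open B7Prop1Explicit (treeWord seg l1 e e_apply disp disp_treeWord)
open B5Eq118OneStroke (iterBlockOf val_iterBlockOf)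
open B15DeterminingSets (embIter)
open Summit.QuantumFields.YangMills.Theorems.Prop7FlatHolonomy (sitesPerDir_zero_eq_mul_pow)

/-! ## §1 Lattice bookkeeping -/

section Words

variable {d : ℕ}

/-- The coordinates of B7's displacement vector are the tree's net displacements. [folklore] -/
theorem disp_apply_eq_netDisp : ∀ (w : List (B7Prop1Explicit.Letter d)) (ν : Fin d), disp w ν = netDisp w ν
  | [], ν => by simp [netDisp]
  | (μ, b) :: w, ν => by
    rw [B7Prop1Explicit.disp_cons, netDisp_cons, Pi.add_apply, disp_apply_eq_netDisp w ν]
    cases b <;> by_cases h : μ = ν <;> simp [B7Prop1Explicit.Letter.vec, e_apply, h, eq_comm]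

/-- The comb word `Γ_{0,v}` has net displacement `v`. [cite: Balaban1984PropagatorsI, (1.7) p.18] -/
theorem netDisp_treeWord (v : B7Prop1Explicit.Site d) (ν : Fin d) : netDisp (treeWord v) ν = v ν := by
  rw [← disp_apply_eq_netDisp, disp_treeWord]
end Words
section Torus

variable {P : Params} {j : ℕ}

/-- The comb `Γ_{y,x}` spelled from `y` ends at `x`. [cite: Balaban1985Averaging, p.24] -/
theorem walkEnd_treeWord_rel (y x : Site P j) : walkEnd y (treeWord (rel y x)) = x := by
  funext ν
  rw [walkEnd_apply, netDisp_treeWord, rel_apply, ZMod.coe_valMinAbs]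
  ring
end Torus
section Centres

variable {P : Params}

/-- **UNIFORM CENTRE OFFSET**: one `off` (`2·off + 1 ≤ L^k`) with `(embIter k y)_μ = y_μ·L^k + off` for ALL `y`, `μ`. [cite: Balaban1987RG1, (0.1) p.252] -/
theorem exists_off_embIter : ∀ (k : ℕ), k ≤ P.m + P.K →
    ∃ off : ℕ, 2 * off + 1 ≤ P.L ^ k ∧ ∀ (y : Site P k) (μ : Fin P.d), ((embIter k y) μ).val = (y μ).val * P.L ^ k + off
  | 0, _ => ⟨0, by simp, fun y μ => by simp [embIter]⟩
  | k + 1, hk => by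
    obtain ⟨off, hle, hoff⟩ := exists_off_embIter k (Nat.le_of_succ_le hk)
    refine ⟨(P.L - 1) / 2 * P.L ^ k + off, ?_, fun y μ => ?_⟩
    · have hL : 1 < P.L := P.hL.2
      have h2 : 2 * ((P.L - 1) / 2) ≤ P.L - 1 := Nat.mul_div_le (P.L - 1) 2
      have hpos : 0 < P.L ^ k := pow_pos P.L_pos k
      calc 2 * ((P.L - 1) / 2 * P.L ^ k + off) + 1 = (2 * ((P.L - 1) / 2)) * P.L ^ k + (2 * off + 1) := by ring
        _ ≤ (P.L - 1) * P.L ^ k + P.L ^ k := add_le_add (Nat.mul_le_mul_right _ h2) hle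
        _ = P.L ^ (k + 1) := by
            rw [pow_succ]
            zify [hL.le]
            ring
    · show ((embIter k (emb y)) μ).val = _
      rw [hoff, Site.val_emb hk, pow_succ]
      ring

/-- **The centre moves with the block**: `embIter k (y + e_μ) = embIter k y + L^k·e_μ` on the finest torus. [cite: Balaban1987RG1, (0.1) p.252] -/
theorem embIter_shift {k : ℕ} (hk : k ≤ P.m + P.K) (y : Site P k) (μ : Fin P.d) :
    embIter k (y.shift μ) = fun ν => (embIter k y) ν + (if ν = μ then (((P.L ^ k : ℕ) : ℤ) : ZMod (P.sitesPerDir 0)) else 0) := by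
  obtain ⟨off, _, hoff⟩ := exists_off_embIter k hk
  have hN : P.sitesPerDir 0 = P.sitesPerDir k * P.L ^ k := sitesPerDir_zero_eq_mul_pow hk
  funext ν
  rw [← ZMod.natCast_zmod_val ((embIter k (y.shift μ)) ν), ← ZMod.natCast_zmod_val ((embIter k y) ν), hoff, hoff]
  by_cases hν : ν = μ
  · subst hν
    simp only [if_true]
    have hsh : ((y.shift ν) ν).val = ((y ν).val + 1) % P.sitesPerDir k := by
      simp only [Site.shift, Function.update_self]
      rw [ZMod.val_add, ZMod.val_one]
    rw [hsh]
    -- `((y+1) mod N_k)·ℓ + off ≡ (y+1)·ℓ + off  (mod N₀ = N_k·ℓ)`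
    have hmod : ((y ν).val + 1) % P.sitesPerDir k * P.L ^ k + off ≡ ((y ν).val + 1) * P.L ^ k + off [MOD P.sitesPerDir 0] := by
      rw [hN]
      exact ((Nat.mod_modEq ((y ν).val + 1) (P.sitesPerDir k)).mul_right' (P.L ^ k)).add_right off
    rw [(ZMod.natCast_eq_natCast_iff _ _ _).mpr hmod]
    push_cast
    ring
  · simp only [hν, if_false, add_zero]
    have : (y.shift μ) ν = y ν := by simp [Site.shift, Function.update_of_ne hν]
    rw [this]

/-- The relative position from the block centre with the UNIFORM offset: `rel y(x) x ν = (x_ν mod L^k) − off`.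
[cite: Balaban1984PropagatorsI, (1.6)-(1.7) p.18] -/
theorem rel_centre_eq_off {k : ℕ} (hk : k ≤ P.m + P.K) {off : ℕ} (hle : 2 * off + 1 ≤ P.L ^ k)
    (hoff : ∀ (y : Site P k) (μ : Fin P.d), ((embIter k y) μ).val = (y μ).val * P.L ^ k + off) (x : Site P 0) (ν : Fin P.d) :
    rel (embIter k (iterBlockOf k x)) x ν = (((x ν).val % P.L ^ k : ℕ) : ℤ) - (off : ℤ) := by
  have hoff' := hoff (iterBlockOf k x) ν
  rw [val_iterBlockOf k hk x ν] at hoff'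
  set N := P.sitesPerDir 0 with hN
  have hNpos : 0 < P.L ^ k := pow_pos P.L_pos k
  have hN2 : 2 * P.L ^ k ≤ N := by
    rw [hN, sitesPerDir_zero_eq_mul_pow hk]
    exact Nat.mul_le_mul_right _ (P.one_lt_sitesPerDir k)
  generalize hq : (x ν).val / P.L ^ k = q at hoff'
  generalize hr : (x ν).val % P.L ^ k = r
  have hdm : (x ν).val = P.L ^ k * q + r := by rw [← hq, ← hr]; exact (Nat.div_add_mod _ _).symm
  have hmod : r < P.L ^ k := by rw [← hr]; exact Nat.mod_lt _ hNpos
  have e1 : (((x ν).val : ℕ) : ℤ) = ((P.L ^ k : ℕ) : ℤ) * q + r := by exact_mod_cast hdm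
  have e2 : (((embIter k (iterBlockOf k x) ν).val : ℕ) : ℤ) = (q : ℤ) * ((P.L ^ k : ℕ) : ℤ) + off := by exact_mod_cast hoff'
  have hint : (((x ν).val : ℕ) : ℤ) - (((embIter k (iterBlockOf k x) ν).val : ℕ) : ℤ) = (r : ℤ) - (off : ℤ) := by
    linear_combination e1 - e2
  rw [rel_apply]
  apply (ZMod.valMinAbs_spec _ _).mpr
  constructor
  · have hx : (x ν : ZMod N) = ((((x ν).val : ℕ) : ℤ) : ZMod N) := by rw [Int.cast_natCast, ZMod.natCast_zmod_val]
    have hc : ((embIter k (iterBlockOf k x)) ν : ZMod N) = ((((embIter k (iterBlockOf k x) ν).val : ℕ) : ℤ) : ZMod N) := by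
      rw [Int.cast_natCast, ZMod.natCast_zmod_val]
    rw [hx, hc, ← Int.cast_sub, hint]
  · have hℓ2 : ((P.L ^ k : ℕ) : ℤ) * 2 ≤ (N : ℤ) := by exact_mod_cast (show P.L ^ k * 2 ≤ N by omega)
    have hr' : (r : ℤ) + 1 ≤ ((P.L ^ k : ℕ) : ℤ) := by exact_mod_cast hmod
    have hoff2 : (off : ℤ) * 2 + 1 ≤ ((P.L ^ k : ℕ) : ℤ) := by exact_mod_cast (show off * 2 + 1 ≤ P.L ^ k by omega)
    have hr0 : (0 : ℤ) ≤ r := by positivity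
    have ho0 : (0 : ℤ) ≤ off := by positivity
    constructor <;> linarith

/-- Across a face in direction `μ` (`x_μ ≡ L^k − 1 mod L^k`) the next site starts the next block: `(x + e_μ)_μ ≡ 0 mod L^k`.
[cite: Balaban1984PropagatorsI, (1.6) p.18] -/
theorem val_shift_mod_of_face {k : ℕ} (hk : k ≤ P.m + P.K) (x : Site P 0) (μ : Fin P.d) (hface : (x μ).val % P.L ^ k = P.L ^ k - 1) :
    ((x.shift μ) μ).val % P.L ^ k = 0 := by
  have hN : P.sitesPerDir 0 = P.sitesPerDir k * P.L ^ k := sitesPerDir_zero_eq_mul_pow hk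
  have hpos : 0 < P.L ^ k := pow_pos P.L_pos k
  have hsh : ((x.shift μ) μ).val = ((x μ).val + 1) % P.sitesPerDir 0 := by
    simp only [Site.shift, Function.update_self]
    rw [ZMod.val_add, ZMod.val_one]
  have hdvd : P.L ^ k ∣ P.sitesPerDir 0 := ⟨P.sitesPerDir k, by rw [hN, mul_comm]⟩
  rw [hsh, Nat.mod_mod_of_dvd _ hdvd]
  have hdm := Nat.div_add_mod ((x μ).val) (P.L ^ k)
  rw [hface] at hdm
  have : (x μ).val + 1 = P.L ^ k * ((x μ).val / P.L ^ k + 1) := by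
    have h1 : P.L ^ k - 1 + 1 = P.L ^ k := Nat.sub_add_cancel hpos
    calc (x μ).val + 1 = P.L ^ k * ((x μ).val / P.L ^ k) + (P.L ^ k - 1) + 1 := by rw [hdm]
      _ = P.L ^ k * ((x μ).val / P.L ^ k + 1) := by rw [add_assoc, h1]; ring
  rw [this, Nat.mul_mod_right]

/-- Across a face the `k`-block changes to the neighbouring one: `B^k(x + e_μ) = B^k(x) + e_μ`. [cite: Balaban1984PropagatorsI, (1.6) p.18] -/
theorem iterBlockOf_shift_of_face {k : ℕ} (hk : k ≤ P.m + P.K) (x : Site P 0) (μ : Fin P.d) (hface : (x μ).val % P.L ^ k = P.L ^ k - 1) :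
    iterBlockOf k (x.shift μ) = (iterBlockOf k x).shift μ := by
  have hN : P.sitesPerDir 0 = P.sitesPerDir k * P.L ^ k := sitesPerDir_zero_eq_mul_pow hk
  have hpos : 0 < P.L ^ k := pow_pos P.L_pos k
  funext ν
  apply ZMod.val_injective
  rw [val_iterBlockOf k hk]
  by_cases hν : ν = μ
  · subst hν
    have hsh : ((x.shift ν) ν).val = ((x ν).val + 1) % P.sitesPerDir 0 := by
      simp only [Site.shift, Function.update_self]; rw [ZMod.val_add, ZMod.val_one]
    have hsh' : (((iterBlockOf k x).shift ν) ν).val = (((iterBlockOf k x) ν).val + 1) % P.sitesPerDir k := by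
      simp only [Site.shift, Function.update_self]; rw [ZMod.val_add, ZMod.val_one]
    rw [hsh, hsh', val_iterBlockOf k hk]
    have e : ((x ν).val + 1) % P.sitesPerDir 0 / P.L ^ k = ((x ν).val + 1) % (P.sitesPerDir k * P.L ^ k) / P.L ^ k :=
      congrArg (fun nn : ℕ => ((x ν).val + 1) % nn / P.L ^ k) hN
    rw [e]
    have hdm := Nat.div_add_mod ((x ν).val) (P.L ^ k)
    rw [hface] at hdm
    set q := (x ν).val / P.L ^ k
    have hx1 : (x ν).val + 1 = (q + 1) * P.L ^ k := by
      have h1 : P.L ^ k - 1 + 1 = P.L ^ k := Nat.sub_add_cancel hpos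
      calc (x ν).val + 1 = P.L ^ k * q + (P.L ^ k - 1) + 1 := by rw [hdm]
        _ = (q + 1) * P.L ^ k := by rw [add_assoc, h1]; ring
    rw [hx1, Nat.mul_mod_mul_right, Nat.mul_div_cancel _ hpos]
  · have h1 : (x.shift μ) ν = x ν := by simp [Site.shift, Function.update_of_ne hν]
    have h2 : ((iterBlockOf k x).shift μ) ν = (iterBlockOf k x) ν := by simp [Site.shift, Function.update_of_ne hν]
    rw [h1, h2, val_iterBlockOf k hk]
end Centres

/-! ## §2 Generic pieces: the face word, its holonomy in the comb-axial gauge, the group algebra -/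

section Generic

variable {P : Params} {G : Type*} [GaugeGroup G]

/-- Holonomy of the face word `Γ_{y,x} ∪ [x, x+e_μ] ∪ (−Γ_{y′,x+e_μ})` in the comb-axial gauge: `W(Γ₂) = U₀(Γ_{y,x})·W_b·U₀(Γ_{y′,x+e_μ})⁻¹`. [cite: Balaban1985RegularSpaces, (1.26) p.79] -/
theorem holAt_faceWord_of_axial {j : ℕ} (W U₀ : GaugeField P j G) (cy cy' x : Site P j) (μ : Fin P.d)
    (hax : axialT W cy x = axialT U₀ cy x) (hax' : axialT W cy' (x.shift μ) = axialT U₀ cy' (x.shift μ)) :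
    holAt W (walk cy (treeWord (rel cy x) ++ [(μ, true)] ++ wordRev (treeWord (rel cy' (x.shift μ))))) =
      axialT U₀ cy x * W ⟨x, μ⟩ * (axialT U₀ cy' (x.shift μ))⁻¹ := by
  have hx'end := walkEnd_treeWord_rel cy' (x.shift μ)
  rw [walk_append, holAt_append, walk_append, holAt_append, walkEnd_append, walkEnd_treeWord_rel]
  rw [← holT_eq_holAt, show B10Eq27TorusAxialLog.holT W cy (treeWord (rel cy x)) = axialT W cy x from rfl, hax]
  have h2 : walkEnd x [(μ, true)] = x.shift μ := rfl
  have hrev : holAt W (walk (x.shift μ) (wordRev (treeWord (rel cy' (x.shift μ))))) =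
      (holAt W (walk cy' (treeWord (rel cy' (x.shift μ)))))⁻¹ := by
    have := holAt_walk_wordRev W cy' (treeWord (rel cy' (x.shift μ)))
    rwa [hx'end] at this
  rw [h2, hrev, ← holT_eq_holAt W cy',
    show B10Eq27TorusAxialLog.holT W cy' (treeWord (rel cy' (x.shift μ))) = axialT W cy' (x.shift μ) from rfl, hax']
  simp [walk, holAt_cons, holAt_nil]

/-- The net displacement of the face word: `rel y x + e_μ − rel y′ (x + e_μ)`. [folklore] -/
theorem netDisp_faceWord {j : ℕ} (cy cy' x x' : Site P j) (μ ν : Fin P.d) :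
    netDisp (treeWord (rel cy x) ++ [(μ, true)] ++ wordRev (treeWord (rel cy' x'))) ν =
      rel cy x ν + (if μ = ν then 1 else 0) - rel cy' x' ν := by
  rw [netDisp_append, netDisp_append, netDisp_treeWord, netDisp_wordRev, netDisp_treeWord, netDisp_cons]
  simp only [netDisp, List.map_nil, List.sum_nil, add_zero, if_true]
  ring

omit [GaugeGroup G] in
/-- Group algebra of the face bound: `W(Γ₂) = H·W_b·H′⁻¹`, `U₀(Γ₂) = H·U₀,b·H′⁻¹` ⟹ three-term `dist1` bound through any `V_W, V₀`. [cite: Balaban1985Averaging, (19)-(20) p.21] -/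
theorem dist1_mul_inv_le_three {G : Type*} [GaugeGroup G] {Wb Ub H H' GW G₀ : G} (VW V₀ : G)
    (hGW : GW = H * Wb * H'⁻¹) (hG₀ : G₀ = H * Ub * H'⁻¹) :
    dist1 (Wb * Ub⁻¹) ≤ dist1 (VW * GW⁻¹) + dist1 (VW * V₀⁻¹) + dist1 (V₀ * G₀⁻¹) := by
  have hkey : Wb * Ub⁻¹ = H⁻¹ * ((VW * GW⁻¹)⁻¹ * (VW * V₀⁻¹) * (V₀ * G₀⁻¹)) * H⁻¹⁻¹ := by
    have eW : Wb = H⁻¹ * GW * H' := by rw [hGW]; group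
    have eU : Ub = H⁻¹ * G₀ * H' := by rw [hG₀]; group
    rw [eW, eU]; group
  rw [hkey, GaugeGroup.dist1_conj]
  calc dist1 ((VW * GW⁻¹)⁻¹ * (VW * V₀⁻¹) * (V₀ * G₀⁻¹))
      ≤ dist1 ((VW * GW⁻¹)⁻¹ * (VW * V₀⁻¹)) + dist1 (V₀ * G₀⁻¹) := GaugeGroup.dist1_mul_le _ _
    _ ≤ (dist1 ((VW * GW⁻¹)⁻¹) + dist1 (VW * V₀⁻¹)) + dist1 (V₀ * G₀⁻¹) := add_le_add (GaugeGroup.dist1_mul_le _ _) le_rfl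
    _ = dist1 (VW * GW⁻¹) + dist1 (VW * V₀⁻¹) + dist1 (V₀ * G₀⁻¹) := by rw [GaugeGroup.dist1_inv]

/-- The face word from the centre of the block of `x` (on the face) has net displacement `L^k e_μ`. [cite: Balaban1984PropagatorsI, (1.6)-(1.7) p.18] -/
theorem netDisp_faceWord_centre {k : ℕ} (hk : k ≤ P.m + P.K) (x : Site P 0) (μ : Fin P.d) (hface : (x μ).val % P.L ^ k = P.L ^ k - 1) (ν : Fin P.d) :
    netDisp (treeWord (rel (embIter k (iterBlockOf k x)) x) ++ [(μ, true)] ++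
        wordRev (treeWord (rel (embIter k (iterBlockOf k (x.shift μ))) (x.shift μ)))) ν =
      if μ = ν then (((P.L ^ k : ℕ) : ℤ)) else 0 := by
  obtain ⟨off, hle, hoff⟩ := exists_off_embIter (P := P) k hk
  rw [netDisp_faceWord, rel_centre_eq_off hk hle hoff x ν, rel_centre_eq_off hk hle hoff (x.shift μ) ν]
  by_cases hν : μ = ν
  · subst hν
    simp only [if_true]
    rw [hface, val_shift_mod_of_face hk x μ hface]
    have hpos : 1 ≤ P.L ^ k := Nat.one_le_pow _ _ P.L_pos
    push_cast [Nat.cast_sub hpos]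
    ring
  · simp only [hν, if_false]
    have : (x.shift μ) ν = x ν := by
      simp only [Site.shift]; rw [Function.update_of_ne (Ne.symm hν)]
    rw [this]; ring

/-- … hence it ends at the centre of the neighbouring block. [cite: Balaban1984PropagatorsI, (1.6)-(1.7) p.18] -/
theorem walkEnd_faceWord_centre {k : ℕ} (hk : k ≤ P.m + P.K) (x : Site P 0) (μ : Fin P.d) (hface : (x μ).val % P.L ^ k = P.L ^ k - 1) :
    walkEnd (embIter k (iterBlockOf k x)) (treeWord (rel (embIter k (iterBlockOf k x)) x) ++ [(μ, true)] ++
        wordRev (treeWord (rel (embIter k (iterBlockOf k (x.shift μ))) (x.shift μ)))) =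
      embIter k ((iterBlockOf k x).shift μ) := by
  funext ν
  rw [walkEnd_apply, netDisp_faceWord_centre hk x μ hface ν, embIter_shift hk (iterBlockOf k x) μ]
  by_cases hν : ν = μ
  · subst hν; simp
  · simp [hν, Ne.symm hν]

/-- The face word has at most `2d(L^k − 1) + 1` letters. [cite: Balaban1984PropagatorsI, (1.7) p.18] -/
theorem length_faceWord_le {k : ℕ} (hk : k ≤ P.m + P.K) (x : Site P 0) (μ : Fin P.d) :
    (treeWord (rel (embIter k (iterBlockOf k x)) x) ++ [(μ, true)] ++
        wordRev (treeWord (rel (embIter k (iterBlockOf k (x.shift μ))) (x.shift μ)))).length ≤ 2 * (P.d * (P.L ^ k - 1)) + 1 := by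
  have h1 := Summit.QuantumFields.YangMills.Theorems.Prop7AxialGaugeBlock.l1_rel_centre_le (P := P) hk x
  have h2 := Summit.QuantumFields.YangMills.Theorems.Prop7AxialGaugeBlock.l1_rel_centre_le (P := P) hk (x.shift μ)
  rw [← B7Prop1Explicit.length_treeWord] at h1 h2
  simp only [List.length_append, List.length_singleton, wordRev, List.length_reverse, List.length_map]
  omega
end Generic

/-! ## §3 The face bonds at the d = 3 carrier -/

section T3

open Literature.MathematicalPhysics.QuantumFieldTheory.Balaban1983to89.T3ContinuumYM3Torus
open Literature.MathematicalPhysics.QuantumFieldTheory.Balaban1983to89.T3RegularMinimiser (regThreshold)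
open Literature.MathematicalPhysics.QuantumFieldTheory.Balaban1983to89.T3PrintedRegularMinimiser (RegPr RegPr.plaqSmall)
open Summit.QuantumFields.YangMills.Theorems.IterPlaqSmall (dist1_contour_iter_le_T3)

variable (F : T3Family) (n K : ℕ)

/-- The transport comparison of the ★19200-p2 lineage read on the face word from a block centre: the `(K−n)`-fold (0.4)-average at the coarse bond
`⟨B(x), μ⟩` is within `B(e) = (100L^{2k} + (7L^k)²/4)·e·L^{−2k}` of the holonomy of `U` along the face word, `k = K − n`, `L ≥ 7`, `50(500L+7L²)e ≤ 1`.
[cite: Balaban1987RG1, (0.4) p.253; Balaban1985RegularSpaces, (1.26) p.79] -/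
theorem dist1_iter_mul_inv_holAt_faceWord_le_T3 (hL : 7 ≤ F.L) {e : ℝ} (he : 0 < e) (hε : 50 * (500 * (F.L : ℝ) + 7 * (F.L : ℝ) ^ 2) * e ≤ 1)
    (U : GaugeField (F.P K) 0 (Matrix.specialUnitaryGroup (Fin 2) ℂ)) (hU : RegPr F n K e U)
    (x : Site (F.P K) 0) (μ : Fin (F.P K).d) (hface : (x μ).val % F.L ^ (K - n) = F.L ^ (K - n) - 1) :
    dist1 (Averaging.iter (fun j => blockAvg (P := F.P K) (j := j) (ExpMeanLog.expMeanLogSU (n := Fin 2))) (K - n) U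
        ⟨iterBlockOf (K - n) x, μ⟩ *
      (holAt U (walk (embIter (K - n) (iterBlockOf (K - n) x))
        (treeWord (rel (embIter (K - n) (iterBlockOf (K - n) x)) x) ++ [(μ, true)] ++
          wordRev (treeWord (rel (embIter (K - n) (iterBlockOf (K - n) (x.shift μ))) (x.shift μ))))))⁻¹) ≤
      (100 * (F.L : ℝ) ^ (2 * (K - n)) + (7 * (F.L : ℝ) ^ (K - n)) ^ 2 / 4) * regThreshold F n K e := by
  have hk : K - n ≤ (F.P K).m + (F.P K).K := by show K - n ≤ F.m + K; omega
  have hface' : (x μ).val % (F.P K).L ^ (K - n) = (F.P K).L ^ (K - n) - 1 := hface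
  have hclosed : ∀ ν, netDisp ([] : List (Letter (F.P K).d)) ν +
      (if (⟨iterBlockOf (K - n) x, μ⟩ : PBond (F.P K) (K - n)).dir = ν then ((((F.P K).L ^ (K - n) : ℕ) : ℤ)) else 0) -
      netDisp (treeWord (rel (embIter (K - n) (iterBlockOf (K - n) x)) x) ++ [(μ, true)] ++
          wordRev (treeWord (rel (embIter (K - n) (iterBlockOf (K - n) (x.shift μ))) (x.shift μ)))) ν = 0 := by
    intro ν
    rw [netDisp_faceWord_centre hk x μ hface' ν]
    simp
  have H := dist1_contour_iter_le_T3 F n K hL he hε embIter (fun _ => rfl) (fun _ _ => rfl) U (RegPr.plaqSmall hU) (le_refl (K - n))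
    ⟨iterBlockOf (K - n) x, μ⟩ (embIter (K - n) (iterBlockOf (K - n) x)) [] _ rfl (walkEnd_faceWord_centre hk x μ hface') hclosed
  simp only [walk, holAt_nil, one_mul, List.length_nil, Nat.cast_zero, zero_add] at H
  refine H.trans ?_
  have hlen := length_faceWord_le hk x μ
  have hd : (F.P K).d = 3 := T3Family.P_d F K
  have hpos : 1 ≤ F.L ^ (K - n) := Nat.one_le_pow _ _ (by omega)
  have hlenR : ((treeWord (rel (embIter (K - n) (iterBlockOf (K - n) x)) x) ++ [(μ, true)] ++
          wordRev (treeWord (rel (embIter (K - n) (iterBlockOf (K - n) (x.shift μ))) (x.shift μ)))).length : ℝ) ≤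
      6 * (F.L : ℝ) ^ (K - n) - 5 := by
    have h3 : 2 * ((F.P K).d * ((F.P K).L ^ (K - n) - 1)) + 1 = 6 * (F.L ^ (K - n) - 1) + 1 := by rw [hd]; show 2 * (3 * (F.L ^ (K - n) - 1)) + 1 = _; ring
    rw [h3] at hlen
    have hcast : ((6 * (F.L ^ (K - n) - 1) + 1 : ℕ) : ℝ) = 6 * (F.L : ℝ) ^ (K - n) - 5 := by
      rw [Nat.cast_add, Nat.cast_mul, Nat.cast_sub hpos]; push_cast; ring
    rw [← hcast]; exact_mod_cast hlen
  have hreg : 0 ≤ regThreshold F n K e := by unfold regThreshold; positivity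
  apply mul_le_mul_of_nonneg_right _ hreg
  have h0 : (0 : ℝ) ≤ (F.L : ℝ) ^ (K - n) + ((treeWord (rel (embIter (K - n) (iterBlockOf (K - n) x)) x) ++ [(μ, true)] ++
          wordRev (treeWord (rel (embIter (K - n) (iterBlockOf (K - n) (x.shift μ))) (x.shift μ)))).length : ℝ) := by positivity
  have h7 : (F.L : ℝ) ^ (K - n) + ((treeWord (rel (embIter (K - n) (iterBlockOf (K - n) x)) x) ++ [(μ, true)] ++
          wordRev (treeWord (rel (embIter (K - n) (iterBlockOf (K - n) (x.shift μ))) (x.shift μ)))).length : ℝ) ≤ 7 * (F.L : ℝ) ^ (K - n) := by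
    linarith
  have hsq := pow_le_pow_left₀ h0 h7 2
  linarith

/-- **[Balaban1985RegularSpaces] LEMMA 1 (1.25), SECOND HALF, `k`-FOLD RELATIVE FORM AT THE CARRIER — THE FACE BONDS.**  Block size `L ≥ 7`; radii with
`50(500L + 7L²)e ≤ 1`; `W ∈ 𝔘_k(e_W)`, `U₀ ∈ 𝔘_k(e₀)` (plaquette clause of (2)); `W` in the complete `(K−n)`-fold comb axial gauge relative to `U₀`; the two
`(K−n)`-fold (0.4)-averages within `β` of each other at every coarse bond; `b = ⟨x, μ⟩` a FACE bond (`x_μ ≡ L^{K−n} − 1 mod L^{K−n}`).  Then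
`dist1(W_bU₀,b⁻¹) ≤ B(e_W) + β + B(e₀)`, `B(e) = (100·L^{2(K−n)} + (7·L^{K−n})²/4)·e·L^{−2(K−n)}` (`≤ 112.25·e`).
[cite: Balaban1985RegularSpaces, Lemma 1 (1.25) p.79; Balaban1987RG1, (0.4) p.253] -/
theorem dist1_mul_inv_le_face_T3 (hL : 7 ≤ F.L) {eW e₀ β : ℝ} (heW : 0 < eW) (he₀ : 0 < e₀)
    (hεW : 50 * (500 * (F.L : ℝ) + 7 * (F.L : ℝ) ^ 2) * eW ≤ 1) (hε₀ : 50 * (500 * (F.L : ℝ) + 7 * (F.L : ℝ) ^ 2) * e₀ ≤ 1)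
    (W U₀ : GaugeField (F.P K) 0 (Matrix.specialUnitaryGroup (Fin 2) ℂ)) (hW : RegPr F n K eW W) (hU₀ : RegPr F n K e₀ U₀)
    (hax : ∀ x : Site (F.P K) 0, axialT W (embIter (K - n) (iterBlockOf (K - n) x)) x = axialT U₀ (embIter (K - n) (iterBlockOf (K - n) x)) x)
    (hmid : ∀ c : PBond (F.P K) (K - n),
      dist1 (Averaging.iter (fun j => blockAvg (P := F.P K) (j := j) (ExpMeanLog.expMeanLogSU (n := Fin 2))) (K - n) W c *
        (Averaging.iter (fun j => blockAvg (P := F.P K) (j := j) (ExpMeanLog.expMeanLogSU (n := Fin 2))) (K - n) U₀ c)⁻¹) ≤ β)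
    (x : Site (F.P K) 0) (μ : Fin (F.P K).d) (hface : (x μ).val % F.L ^ (K - n) = F.L ^ (K - n) - 1) :
    dist1 (W ⟨x, μ⟩ * (U₀ ⟨x, μ⟩)⁻¹) ≤
      (100 * (F.L : ℝ) ^ (2 * (K - n)) + (7 * (F.L : ℝ) ^ (K - n)) ^ 2 / 4) * (regThreshold F n K eW + regThreshold F n K e₀) + β := by
  have hk : K - n ≤ (F.P K).m + (F.P K).K := by show K - n ≤ F.m + K; omega
  have hface' : (x μ).val % (F.P K).L ^ (K - n) = (F.P K).L ^ (K - n) - 1 := hface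
  have hblk : iterBlockOf (K - n) (x.shift μ) = (iterBlockOf (K - n) x).shift μ := iterBlockOf_shift_of_face hk x μ hface'
  have HW := dist1_iter_mul_inv_holAt_faceWord_le_T3 F n K hL heW hεW W hW x μ hface
  have HU := dist1_iter_mul_inv_holAt_faceWord_le_T3 F n K hL he₀ hε₀ U₀ hU₀ x μ hface
  have hax' : axialT W (embIter (K - n) (iterBlockOf (K - n) (x.shift μ))) (x.shift μ) =
      axialT U₀ (embIter (K - n) (iterBlockOf (K - n) (x.shift μ))) (x.shift μ) := hax (x.shift μ)
  have hGW := holAt_faceWord_of_axial W U₀ (embIter (K - n) (iterBlockOf (K - n) x)) (embIter (K - n) (iterBlockOf (K - n) (x.shift μ))) x μ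
    (hax x) hax'
  have hG₀ := holAt_faceWord_of_axial U₀ U₀ (embIter (K - n) (iterBlockOf (K - n) x)) (embIter (K - n) (iterBlockOf (K - n) (x.shift μ))) x μ
    rfl rfl
  have h3 := dist1_mul_inv_le_three
    (Averaging.iter (fun j => blockAvg (P := F.P K) (j := j) (ExpMeanLog.expMeanLogSU (n := Fin 2))) (K - n) W ⟨iterBlockOf (K - n) x, μ⟩)
    (Averaging.iter (fun j => blockAvg (P := F.P K) (j := j) (ExpMeanLog.expMeanLogSU (n := Fin 2))) (K - n) U₀ ⟨iterBlockOf (K - n) x, μ⟩)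
    hGW hG₀
  have hm := hmid ⟨iterBlockOf (K - n) x, μ⟩
  linarith

/-- **TWO ELEMENTS WITH THE SAME (0.4)-DESCENT** (`β = 0`; e.g. `W, U₀ ∈ 𝔅_k(V)`): `W` comb-axial relative to `U₀`, both regular, `L ≥ 7`:
`dist1(W_bU₀,b⁻¹) ≤ (100L^{2k} + (7L^k)²/4)·(e_W + e₀)·L^{−2k} ≤ 112.25·(e_W + e₀)` on every face bond — `O(ε₀)`, uniformly in `k = K − n`.
[cite: Balaban1985RegularSpaces, Lemma 1 (1.25) p.79; Balaban1985Variational, (3)-(4) p.278] -/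
theorem dist1_mul_inv_le_face_of_descent_eq_T3 (hL : 7 ≤ F.L) {eW e₀ : ℝ} (heW : 0 < eW) (he₀ : 0 < e₀)
    (hεW : 50 * (500 * (F.L : ℝ) + 7 * (F.L : ℝ) ^ 2) * eW ≤ 1) (hε₀ : 50 * (500 * (F.L : ℝ) + 7 * (F.L : ℝ) ^ 2) * e₀ ≤ 1)
    (W U₀ : GaugeField (F.P K) 0 (Matrix.specialUnitaryGroup (Fin 2) ℂ)) (hW : RegPr F n K eW W) (hU₀ : RegPr F n K e₀ U₀)
    (hax : ∀ x : Site (F.P K) 0, axialT W (embIter (K - n) (iterBlockOf (K - n) x)) x = axialT U₀ (embIter (K - n) (iterBlockOf (K - n) x)) x)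
    (hdesc : Averaging.iter (fun j => blockAvg (P := F.P K) (j := j) (ExpMeanLog.expMeanLogSU (n := Fin 2))) (K - n) W =
      Averaging.iter (fun j => blockAvg (P := F.P K) (j := j) (ExpMeanLog.expMeanLogSU (n := Fin 2))) (K - n) U₀)
    (x : Site (F.P K) 0) (μ : Fin (F.P K).d) (hface : (x μ).val % F.L ^ (K - n) = F.L ^ (K - n) - 1) :
    dist1 (W ⟨x, μ⟩ * (U₀ ⟨x, μ⟩)⁻¹) ≤
      (100 * (F.L : ℝ) ^ (2 * (K - n)) + (7 * (F.L : ℝ) ^ (K - n)) ^ 2 / 4) * ((eW + e₀) * (((F.L : ℝ))⁻¹) ^ (2 * (K - n))) := by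
  have h := dist1_mul_inv_le_face_T3 F n K hL heW he₀ hεW hε₀ W U₀ hW hU₀ hax (β := 0)
    (fun c => by rw [hdesc, mul_inv_cancel, GaugeGroup.dist1_one]) x μ hface
  rw [add_zero] at h
  refine h.trans (le_of_eq ?_)
  unfold regThreshold; ring

end T3

end Summit.QuantumFields.YangMills.Theorems.Prop7AxialGaugeFace
end
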